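import Mathlib.Analysis.Convex.Segment
import Literature.Probability.RandomPlanarGeometry.USTPeanoParity
import Literature.Probability.RandomPlanarGeometry.USTPeanoDomain
import HarnessLib

/-!
# Manhattan edges versus the lattice walls: coordinate geometry ([LSW04] §4.1)

The Peano paths of `D(α, β, a, b)` are required not to meet `α ∪ β` ([LSW04] §4.1: "edges of
`G⃗` which do not intersect `T ∪ T†`"); `USTPeano.PeanoPath.disjoint_edge` states this for the
closed segments of `ℂ`. This file translates the condition into the index combinatorics of
`USTPeanoManhattan.lean`:

* `USTPeano.stepP_and_edge_eq_of_mem` — if the closed Manhattan edge `[p, q]` meets the closed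
  primal lattice edge `[u, u']`, then `q = stepP p` and `{u, u'}` is the primal edge
  `{primalNbr p, farP p}` (the edge `p → stepD p` meets no primal line; `p → stepP p` meets the
  primal lines only in its midpoint, which lies on exactly one primal edge);
  `USTPeano.primalPt_notMem_segment` — no primal vertex lies on a Manhattan edge; hence
  `USTPeano.disjoint_segment_primalPathSet`: a Manhattan edge not crossing an edge of the
  lattice path `α` combinatorially misses `primalPathSet α`;
* the dual statements (`stepD_and_edge_eq_of_mem`, `disjoint_segment_dualPathSet`), obtained
  through the reflection `swapC z = (½ - im z) + (½ - re z) i` of `ℂ` in the line `x + y = ½`,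
  which realises `swapIdx` on all three lattices (`swapC_peanoPt`, `swapC_primalPt`,
  `swapC_dualPt`);
* `USTPeano.eq_peanoPt_of_mem_diag` — a Manhattan edge meets a diagonal `[x, v]` from a Peano
  vertex `x` to an adjacent primal or dual vertex `v` (the four junction segments
  `[a, α_a], [a, β_a], [b, α_b], [b, β_b]` of the boundary polygon) only at `x`, and only if `x`
  is an endpoint of the edge.

Everything is elementary real arithmetic on the coordinates `re`, `im`.
-/

noncomputable section

open Set Complex

namespace Literature.Probability.RandomPlanarGeometry

namespace USTPeano

/-! ### Coordinates of points on segments -/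

/-- A point of the segment `[x, y]` is `x + b (y - x)` with `b ∈ [0, 1]`, coordinatewise.
[folklore] -/
theorem coords_of_mem_segment {x y z : ℂ} (h : z ∈ segment ℝ x y) :
    ∃ b : ℝ, 0 ≤ b ∧ b ≤ 1 ∧ z.re = x.re + b * (y.re - x.re) ∧ z.im = x.im + b * (y.im - x.im) := by
  obtain ⟨a, b, ha, hb, hab, rfl⟩ := h
  have ha' : a = 1 - b := by linarith
  refine ⟨b, hb, by linarith, ?_, ?_⟩
  · simp only [add_re, smul_re, smul_eq_mul, ha']; ring
  · simp only [add_im, smul_im, smul_eq_mul, ha']; ring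

/-- Conversely, `x + b (y - x)` (coordinatewise, `b ∈ [0, 1]`) lies on `[x, y]`. [folklore] -/
theorem mem_segment_of_eq {x y z : ℂ} {b : ℝ} (hb0 : 0 ≤ b) (hb1 : b ≤ 1)
    (hre : z.re = x.re + b * (y.re - x.re)) (him : z.im = x.im + b * (y.im - x.im)) :
    z ∈ segment ℝ x y := by
  refine ⟨1 - b, b, by linarith, hb0, by ring, ?_⟩
  apply Complex.ext
  · simp only [add_re, smul_re, smul_eq_mul, hre]; ring
  · simp only [add_im, smul_im, smul_eq_mul, him]; ring

/-- An integer strictly between `c - 1` and `c + 1` (real bounds) is `c`. [folklore] -/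
theorem int_eq_of_lt_of_lt {k c : ℤ} (h1 : (c : ℝ) - 1 < k) (h2 : (k : ℝ) < c + 1) : k = c := by
  have h1' : c - 1 < k := by exact_mod_cast h1
  have h2' : k < c + 1 := by exact_mod_cast h2
  omega

/-- There is no integer strictly between `c` and `c + 1` (real bounds); a private copy of the
elementary `Literature.Probability.Percolation.int_not_strict_between` (not imported: that module
carries the triangular-lattice percolation set-up). [folklore] -/
private theorem int_false_of_lt_of_lt {k c : ℤ} (h1 : (c : ℝ) < k) (h2 : (k : ℝ) < c + 1) : False := by
  have h1' : c < k := by exact_mod_cast h1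
  have h2' : k < c + 1 := by exact_mod_cast h2
  omega

/-- An integer in `[c, c + 1]` (real bounds) is `c` or `c + 1`. [folklore] -/
theorem int_eq_or_of_le_of_le {k c : ℤ} (h1 : (c : ℝ) ≤ k) (h2 : (k : ℝ) ≤ c + 1) :
    k = c ∨ k = c + 1 := by
  have h1' : c ≤ k := by exact_mod_cast h1
  have h2' : k ≤ c + 1 := by exact_mod_cast h2
  omega

/-! ### The midpoint of the primal step -/

/-- The midpoint of the Manhattan edge `p → stepP p`: its intersection with the primal edge `f₁`.
[folklore] -/
def midP (p : ℤ × ℤ) : ℂ := ⟨((peanoPt p).re + (peanoPt (stepP p)).re) / 2,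
  ((peanoPt p).im + (peanoPt (stepP p)).im) / 2⟩

section NormalForms

variable (m n : ℤ)

/-- Coordinates of Peano vertices in the parity normal forms. [folklore] -/
theorem peanoPt_re_even (j : ℤ) : (peanoPt (2 * m, j)).re = m + 1 / 4 := by
  rw [peanoPt_re]; push_cast; ring

/-- Coordinates of Peano vertices in the parity normal forms. [folklore] -/
theorem peanoPt_re_odd (j : ℤ) : (peanoPt (2 * m + 1, j)).re = m + 3 / 4 := by
  rw [peanoPt_re]; push_cast; ring

/-- Coordinates of Peano vertices in the parity normal forms. [folklore] -/
theorem peanoPt_im_even (i : ℤ) : (peanoPt (i, 2 * n)).im = n + 1 / 4 := by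
  rw [peanoPt_im]; push_cast; ring

/-- Coordinates of Peano vertices in the parity normal forms. [folklore] -/
theorem peanoPt_im_odd (i : ℤ) : (peanoPt (i, 2 * n + 1)).im = n + 3 / 4 := by
  rw [peanoPt_im]; push_cast; ring

/-- The midpoint in the parity normal forms. [folklore] -/
theorem midP_ee : midP (2 * m, 2 * n) = ⟨m + 1 / 4, n⟩ := by
  apply Complex.ext
  · simp only [midP, stepP_ee, peanoPt_re_even]; ring
  · simp only [midP, stepP_ee, peanoPt_im_even, peanoPt_im_odd]; push_cast; ring

/-- The midpoint in the parity normal forms. [folklore] -/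
theorem midP_eo : midP (2 * m, 2 * n + 1) = ⟨m, n + 3 / 4⟩ := by
  apply Complex.ext
  · simp only [midP, stepP_eo, peanoPt_re_even, peanoPt_re_odd]; push_cast; ring
  · simp only [midP, stepP_eo, peanoPt_im_odd]; ring

/-- The midpoint in the parity normal forms. [folklore] -/
theorem midP_oe : midP (2 * m + 1, 2 * n) = ⟨m + 1, n + 1 / 4⟩ := by
  apply Complex.ext
  · simp only [midP, stepP_oe, peanoPt_re_odd, peanoPt_re_even]; push_cast; ring
  · simp only [midP, stepP_oe, peanoPt_im_even]; ring

/-- The midpoint in the parity normal forms. [folklore] -/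
theorem midP_oo : midP (2 * m + 1, 2 * n + 1) = ⟨m + 3 / 4, n + 1⟩ := by
  apply Complex.ext
  · simp only [midP, stepP_oo, peanoPt_re_odd]; ring
  · simp only [midP, stepP_oo, peanoPt_im_odd, peanoPt_im_even]; push_cast; ring

end NormalForms

/-! ### The primal step meets the primal lines only in its midpoint -/

/-- **A point of the edge `p → stepP p` with an integer coordinate is its midpoint.** [folklore] -/
theorem eq_midP_of_mem_segment_stepP {p : ℤ × ℤ} {z : ℂ}
    (hz : z ∈ segment ℝ (peanoPt p) (peanoPt (stepP p)))
    (hint : (∃ k : ℤ, z.re = k) ∨ ∃ k : ℤ, z.im = k) : z = midP p := by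
  obtain ⟨b, hb0, hb1, hre, him⟩ := coords_of_mem_segment hz
  obtain ⟨m, n, rfl | rfl | rfl | rfl⟩ := parity_cases p
  · rw [midP_ee]
    simp only [stepP_ee, peanoPt_re_even, peanoPt_im_even, peanoPt_im_odd, Int.cast_sub, Int.cast_one] at hre him
    rcases hint with ⟨k, hk⟩ | ⟨k, hk⟩
    · exact (int_false_of_lt_of_lt (k := k) (c := m) (by linarith) (by linarith)).elim
    · have hkn := int_eq_of_lt_of_lt (k := k) (c := n) (by linarith) (by linarith)
      subst hkn
      apply Complex.ext <;> simp <;> linarith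
  · rw [midP_eo]
    simp only [stepP_eo, peanoPt_re_even, peanoPt_re_odd, peanoPt_im_odd, Int.cast_sub, Int.cast_one] at hre him
    rcases hint with ⟨k, hk⟩ | ⟨k, hk⟩
    · have hkn := int_eq_of_lt_of_lt (k := k) (c := m) (by linarith) (by linarith)
      subst hkn
      apply Complex.ext <;> simp <;> linarith
    · exact (int_false_of_lt_of_lt (k := k) (c := n) (by linarith) (by linarith)).elim
  · rw [midP_oe]
    simp only [stepP_oe, peanoPt_re_even, peanoPt_re_odd, peanoPt_im_even, Int.cast_add, Int.cast_one] at hre him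
    rcases hint with ⟨k, hk⟩ | ⟨k, hk⟩
    · have hkn := int_eq_of_lt_of_lt (k := k) (c := m + 1) (by push_cast; linarith)
        (by push_cast; linarith)
      subst hkn
      push_cast at hk
      apply Complex.ext <;> simp <;> linarith
    · exact (int_false_of_lt_of_lt (k := k) (c := n) (by linarith) (by linarith)).elim
  · rw [midP_oo]
    simp only [stepP_oo, peanoPt_re_odd, peanoPt_im_odd, peanoPt_im_even, Int.cast_add, Int.cast_one] at hre him
    rcases hint with ⟨k, hk⟩ | ⟨k, hk⟩
    · exact (int_false_of_lt_of_lt (k := k) (c := m) (by linarith) (by linarith)).elim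
    · have hkn := int_eq_of_lt_of_lt (k := k) (c := n + 1) (by push_cast; linarith)
        (by push_cast; linarith)
      subst hkn
      push_cast at hk
      apply Complex.ext <;> simp <;> linarith

/-- **The edge `p → stepD p` meets no primal line**: none of its points has an integer
coordinate. [folklore] -/
theorem not_int_of_mem_segment_stepD {p : ℤ × ℤ} {z : ℂ}
    (hz : z ∈ segment ℝ (peanoPt p) (peanoPt (stepD p))) (k : ℤ) : z.re ≠ k ∧ z.im ≠ k := by
  obtain ⟨b, hb0, hb1, hre, him⟩ := coords_of_mem_segment hz
  obtain ⟨m, n, rfl | rfl | rfl | rfl⟩ := parity_cases p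
  · simp only [stepD_ee, peanoPt_re_even, peanoPt_re_odd, peanoPt_im_even] at hre him
    exact ⟨fun hk ↦ int_false_of_lt_of_lt (k := k) (c := m) (by linarith) (by linarith),
      fun hk ↦ int_false_of_lt_of_lt (k := k) (c := n) (by linarith) (by linarith)⟩
  · simp only [stepD_eo, peanoPt_re_even, peanoPt_im_odd, peanoPt_im_even] at hre him
    exact ⟨fun hk ↦ int_false_of_lt_of_lt (k := k) (c := m) (by linarith) (by linarith),
      fun hk ↦ int_false_of_lt_of_lt (k := k) (c := n) (by linarith) (by linarith)⟩
  · simp only [stepD_oe, peanoPt_re_odd, peanoPt_im_even, peanoPt_im_odd] at hre him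
    exact ⟨fun hk ↦ int_false_of_lt_of_lt (k := k) (c := m) (by linarith) (by linarith),
      fun hk ↦ int_false_of_lt_of_lt (k := k) (c := n) (by linarith) (by linarith)⟩
  · simp only [stepD_oo, peanoPt_re_odd, peanoPt_re_even, peanoPt_im_odd] at hre him
    exact ⟨fun hk ↦ int_false_of_lt_of_lt (k := k) (c := m) (by linarith) (by linarith),
      fun hk ↦ int_false_of_lt_of_lt (k := k) (c := n) (by linarith) (by linarith)⟩

/-- The midpoint of `p → stepP p` is not a lattice point: one of its coordinates is not an
integer. [folklore] -/
theorem midP_not_int (p : ℤ × ℤ) : (∀ k : ℤ, (midP p).re ≠ k) ∨ ∀ k : ℤ, (midP p).im ≠ k := by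
  obtain ⟨m, n, rfl | rfl | rfl | rfl⟩ := parity_cases p
  · refine Or.inl fun k hk ↦ ?_
    rw [midP_ee] at hk
    exact int_false_of_lt_of_lt (k := k) (c := m) (by simp at hk; linarith) (by simp at hk; linarith)
  · refine Or.inr fun k hk ↦ ?_
    rw [midP_eo] at hk
    exact int_false_of_lt_of_lt (k := k) (c := n) (by simp at hk; linarith) (by simp at hk; linarith)
  · refine Or.inr fun k hk ↦ ?_
    rw [midP_oe] at hk
    exact int_false_of_lt_of_lt (k := k) (c := n) (by simp at hk; linarith) (by simp at hk; linarith)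
  · refine Or.inl fun k hk ↦ ?_
    rw [midP_oo] at hk
    exact int_false_of_lt_of_lt (k := k) (c := m) (by simp at hk; linarith) (by simp at hk; linarith)

/-- **The midpoint lies on exactly one primal edge**, `f₁ = {primalNbr p, farP p}`. [folklore] -/
theorem edge_eq_of_midP_mem {p u u' : ℤ × ℤ} (hadj : LatticeAdj u u')
    (h : midP p ∈ segment ℝ (primalPt u) (primalPt u')) : s(u, u') = s(primalNbr p, farP p) := by
  obtain ⟨b, hb0, hb1, hre, him⟩ := coords_of_mem_segment h
  obtain ⟨i, j⟩ := u; obtain ⟨i', j'⟩ := u'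
  simp only [LatticeAdj] at hadj
  simp only [primalPt_re, primalPt_im] at hre him
  rw [Sym2.eq_iff]
  obtain ⟨m, n, rfl | rfl | rfl | rfl⟩ := parity_cases p <;>
    simp only [midP_ee, midP_eo, midP_oe, midP_oo, primalNbr_ee, primalNbr_eo, primalNbr_oe,
      primalNbr_oo, farP_ee, farP_eo, farP_oe, farP_oo, Prod.mk.injEq] at hre him ⊢
  · -- class ee
    rcases hadj with ⟨h1, h2 | h2⟩ | ⟨h1, h2 | h2⟩
    · rw [h1] at hre; rw [← h2] at him; push_cast at him; ring_nf at hre him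
      exact (int_false_of_lt_of_lt (k := i') (c := m) (by linarith) (by linarith)).elim
    · rw [h1] at hre; rw [← h2] at him; push_cast at him; ring_nf at hre him
      exact (int_false_of_lt_of_lt (k := i') (c := m) (by linarith) (by linarith)).elim
    · rw [h1] at him; rw [← h2] at hre; push_cast at hre; ring_nf at hre him
      have hj : j' = n := by exact_mod_cast him.symm
      have hi := int_eq_of_lt_of_lt (k := i) (c := m) (by linarith) (by linarith)
      omega
    · rw [h1] at him; rw [← h2] at hre; push_cast at hre; ring_nf at hre him
      have hj : j' = n := by exact_mod_cast him.symm
      have hi := int_eq_of_lt_of_lt (k := i') (c := m) (by linarith) (by linarith)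
      omega
  · -- class eo
    rcases hadj with ⟨h1, h2 | h2⟩ | ⟨h1, h2 | h2⟩
    · rw [h1] at hre; rw [← h2] at him; push_cast at him; ring_nf at hre him
      have hi : i' = m := by exact_mod_cast hre.symm
      have hj := int_eq_of_lt_of_lt (k := j) (c := n) (by linarith) (by linarith)
      omega
    · rw [h1] at hre; rw [← h2] at him; push_cast at him; ring_nf at hre him
      have hi : i' = m := by exact_mod_cast hre.symm
      have hj := int_eq_of_lt_of_lt (k := j') (c := n) (by linarith) (by linarith)
      omega
    · rw [h1] at him; rw [← h2] at hre; push_cast at hre; ring_nf at hre him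
      exact (int_false_of_lt_of_lt (k := j') (c := n) (by linarith) (by linarith)).elim
    · rw [h1] at him; rw [← h2] at hre; push_cast at hre; ring_nf at hre him
      exact (int_false_of_lt_of_lt (k := j') (c := n) (by linarith) (by linarith)).elim
  · -- class oe
    rcases hadj with ⟨h1, h2 | h2⟩ | ⟨h1, h2 | h2⟩
    · rw [h1] at hre; rw [← h2] at him; push_cast at him; ring_nf at hre him
      have hi : i' = m + 1 := by
        have h' : (i' : ℝ) = m + 1 := by linarith
        exact_mod_cast h'
      have hj := int_eq_of_lt_of_lt (k := j) (c := n) (by linarith) (by linarith)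
      omega
    · rw [h1] at hre; rw [← h2] at him; push_cast at him; ring_nf at hre him
      have hi : i' = m + 1 := by
        have h' : (i' : ℝ) = m + 1 := by linarith
        exact_mod_cast h'
      have hj := int_eq_of_lt_of_lt (k := j') (c := n) (by linarith) (by linarith)
      omega
    · rw [h1] at him; rw [← h2] at hre; push_cast at hre; ring_nf at hre him
      exact (int_false_of_lt_of_lt (k := j') (c := n) (by linarith) (by linarith)).elim
    · rw [h1] at him; rw [← h2] at hre; push_cast at hre; ring_nf at hre him
      exact (int_false_of_lt_of_lt (k := j') (c := n) (by linarith) (by linarith)).elim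
  · -- class oo
    rcases hadj with ⟨h1, h2 | h2⟩ | ⟨h1, h2 | h2⟩
    · rw [h1] at hre; rw [← h2] at him; push_cast at him; ring_nf at hre him
      exact (int_false_of_lt_of_lt (k := i') (c := m) (by linarith) (by linarith)).elim
    · rw [h1] at hre; rw [← h2] at him; push_cast at him; ring_nf at hre him
      exact (int_false_of_lt_of_lt (k := i') (c := m) (by linarith) (by linarith)).elim
    · rw [h1] at him; rw [← h2] at hre; push_cast at hre; ring_nf at hre him
      have hj : j' = n + 1 := by
        have h' : (j' : ℝ) = n + 1 := by linarith
        exact_mod_cast h'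
      have hi := int_eq_of_lt_of_lt (k := i) (c := m) (by linarith) (by linarith)
      omega
    · rw [h1] at him; rw [← h2] at hre; push_cast at hre; ring_nf at hre him
      have hj : j' = n + 1 := by
        have h' : (j' : ℝ) = n + 1 := by linarith
        exact_mod_cast h'
      have hi := int_eq_of_lt_of_lt (k := i') (c := m) (by linarith) (by linarith)
      omega

/-- A point of a primal lattice edge has an integer coordinate. [folklore] -/
theorem exists_int_of_mem_primalEdge {u u' : ℤ × ℤ} (hadj : LatticeAdj u u') {z : ℂ}
    (hz : z ∈ segment ℝ (primalPt u) (primalPt u')) : (∃ k : ℤ, z.re = k) ∨ ∃ k : ℤ, z.im = k := by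
  obtain ⟨b, -, -, hre, him⟩ := coords_of_mem_segment hz
  simp only [primalPt_re, primalPt_im] at hre him
  rcases hadj with ⟨h1, -⟩ | ⟨h1, -⟩
  · refine Or.inl ⟨u.1, ?_⟩
    rw [hre, h1]; ring
  · refine Or.inr ⟨u.2, ?_⟩
    rw [him, h1]; ring

/-- **A Manhattan edge meeting a primal edge crosses it**: if the closed edge `[p, q]` of `G⃗`
meets the closed primal edge `[u, u']`, then `q = stepP p` and `{u, u'} = {primalNbr p, farP p}`.
[cite: LawlerSchrammWerner2004, §4.1] -/
theorem stepP_and_edge_eq_of_mem {p q u u' : ℤ × ℤ} (hm : Manhattan p q) (hadj : LatticeAdj u u')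
    {z : ℂ} (hz1 : z ∈ segment ℝ (peanoPt p) (peanoPt q))
    (hz2 : z ∈ segment ℝ (primalPt u) (primalPt u')) :
    q = stepP p ∧ s(u, u') = s(primalNbr p, farP p) := by
  have hint := exists_int_of_mem_primalEdge hadj hz2
  rcases (manhattan_iff_step p q).1 hm with rfl | rfl
  · exfalso
    rcases hint with ⟨k, hk⟩ | ⟨k, hk⟩
    · exact (not_int_of_mem_segment_stepD hz1 k).1 hk
    · exact (not_int_of_mem_segment_stepD hz1 k).2 hk
  · have hzm := eq_midP_of_mem_segment_stepP hz1 hint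
    subst hzm
    exact ⟨rfl, edge_eq_of_midP_mem hadj hz2⟩

/-- **No primal vertex lies on a Manhattan edge.** [folklore] -/
theorem primalPt_notMem_segment {p q : ℤ × ℤ} (hm : Manhattan p q) (u : ℤ × ℤ) :
    primalPt u ∉ segment ℝ (peanoPt p) (peanoPt q) := by
  intro hz
  rcases (manhattan_iff_step p q).1 hm with rfl | rfl
  · exact (not_int_of_mem_segment_stepD hz u.1).1 rfl
  · have hzm := eq_midP_of_mem_segment_stepP hz (Or.inl ⟨u.1, rfl⟩)
    rcases midP_not_int p with h | h
    · exact h u.1 (by rw [← hzm]; rfl)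
    · exact h u.2 (by rw [← hzm]; rfl)

/-- **A Manhattan edge which does not cross an edge of the lattice path `α` misses `α`.** Here
"crosses an edge of `α`" is the combinatorial condition `q = stepP p ∧ {primalNbr p, farP p}` is
a pair of consecutive vertices of `α`. [cite: LawlerSchrammWerner2004, §4.1] -/
theorem disjoint_segment_primalPathSet {α : List (ℤ × ℤ)} (hα : α.IsChain LatticeAdj)
    {p q : ℤ × ℤ} (hm : Manhattan p q)
    (h : ∀ e ∈ α.zip α.tail, ¬ (q = stepP p ∧ s(e.1, e.2) = s(primalNbr p, farP p))) :
    Disjoint (segment ℝ (peanoPt p) (peanoPt q)) (Domain.primalPathSet α) := by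
  rw [Set.disjoint_left]
  rintro z hz1 (⟨v, -, rfl⟩ | hz2)
  · exact primalPt_notMem_segment hm v hz1
  · obtain ⟨e, he, hz2⟩ := Set.mem_iUnion₂.1 hz2
    have hadj : LatticeAdj e.1 e.2 := forall_zip_tail_of_isChain hα e he
    exact h e he (stepP_and_edge_eq_of_mem hm hadj hz1 hz2)

/-! ### The reflection exchanging the primal and the dual grid -/

/-- The reflection of `ℂ` in the line `x + y = ½`. [folklore] -/
def swapC (z : ℂ) : ℂ := ⟨1 / 2 - z.im, 1 / 2 - z.re⟩

/-- Real part of the reflection. [folklore] -/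
@[simp] theorem swapC_re (z : ℂ) : (swapC z).re = 1 / 2 - z.im := rfl

/-- Imaginary part of the reflection. [folklore] -/
@[simp] theorem swapC_im (z : ℂ) : (swapC z).im = 1 / 2 - z.re := rfl

/-- The reflection is an involution. [folklore] -/
@[simp] theorem swapC_swapC (z : ℂ) : swapC (swapC z) = z := by
  apply Complex.ext <;> simp

/-- The reflection on Peano vertices is `swapIdx`. [folklore] -/
@[simp] theorem swapC_peanoPt (p : ℤ × ℤ) : swapC (peanoPt p) = peanoPt (swapIdx p) := by
  apply Complex.ext <;> simp [swapIdx] <;> ring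

/-- The reflection maps primal vertices to dual vertices (`swapIdx` on indices). [folklore] -/
@[simp] theorem swapC_primalPt (u : ℤ × ℤ) : swapC (primalPt u) = dualPt (swapIdx u) := by
  apply Complex.ext <;> simp [swapIdx] <;> ring

/-- The reflection maps dual vertices to primal vertices. [folklore] -/
@[simp] theorem swapC_dualPt (w : ℤ × ℤ) : swapC (dualPt w) = primalPt (swapIdx w) := by
  apply Complex.ext <;> simp [swapIdx]

/-- The reflection maps segments to segments. [folklore] -/
theorem swapC_mem_segment {x y z : ℂ} (h : z ∈ segment ℝ x y) :
    swapC z ∈ segment ℝ (swapC x) (swapC y) := by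
  obtain ⟨b, hb0, hb1, hre, him⟩ := coords_of_mem_segment h
  exact mem_segment_of_eq hb0 hb1 (by simp only [swapC_re, him]; ring)
    (by simp only [swapC_im, hre]; ring)

/-- Unordered pairs through `swapIdx`. [folklore] -/
theorem sym2_eq_of_swapIdx {a b c d : ℤ × ℤ} (h : s(swapIdx a, swapIdx b) = s(swapIdx c, swapIdx d)) :
    s(a, b) = s(c, d) := by
  rw [Sym2.eq_iff] at h ⊢
  simpa only [swapIdx_injective.eq_iff] using h

/-- **A Manhattan edge meeting a dual edge crosses it**: if the closed edge `[p, q]` of `G⃗`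
meets the closed dual edge `[w, w']`, then `q = stepD p` and `{w, w'} = {dualNbr p, farD p}`.
[cite: LawlerSchrammWerner2004, §4.1] -/
theorem stepD_and_edge_eq_of_mem {p q w w' : ℤ × ℤ} (hm : Manhattan p q) (hadj : LatticeAdj w w')
    {z : ℂ} (hz1 : z ∈ segment ℝ (peanoPt p) (peanoPt q))
    (hz2 : z ∈ segment ℝ (dualPt w) (dualPt w')) :
    q = stepD p ∧ s(w, w') = s(dualNbr p, farD p) := by
  have hz1' := swapC_mem_segment hz1
  have hz2' := swapC_mem_segment hz2
  rw [swapC_peanoPt, swapC_peanoPt] at hz1'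
  rw [swapC_dualPt, swapC_dualPt] at hz2'
  obtain ⟨h1, h2⟩ := stepP_and_edge_eq_of_mem ((manhattan_swapIdx p q).2 hm)
    ((latticeAdj_swapIdx w w').2 hadj) hz1' hz2'
  rw [stepP_swapIdx, swapIdx_injective.eq_iff] at h1
  rw [primalNbr_swapIdx, farP_swapIdx] at h2
  exact ⟨h1, sym2_eq_of_swapIdx h2⟩

/-- **No dual vertex lies on a Manhattan edge.** [folklore] -/
theorem dualPt_notMem_segment {p q : ℤ × ℤ} (hm : Manhattan p q) (w : ℤ × ℤ) :
    dualPt w ∉ segment ℝ (peanoPt p) (peanoPt q) := by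
  intro hz
  have hz' := swapC_mem_segment hz
  rw [swapC_peanoPt, swapC_peanoPt, swapC_dualPt] at hz'
  exact primalPt_notMem_segment ((manhattan_swapIdx p q).2 hm) _ hz'

/-- **A Manhattan edge which does not cross an edge of the dual lattice path `β` misses `β`.**
[cite: LawlerSchrammWerner2004, §4.1] -/
theorem disjoint_segment_dualPathSet {β : List (ℤ × ℤ)} (hβ : β.IsChain LatticeAdj)
    {p q : ℤ × ℤ} (hm : Manhattan p q)
    (h : ∀ f ∈ β.zip β.tail, ¬ (q = stepD p ∧ s(f.1, f.2) = s(dualNbr p, farD p))) :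
    Disjoint (segment ℝ (peanoPt p) (peanoPt q)) (Domain.dualPathSet β) := by
  rw [Set.disjoint_left]
  rintro z hz1 (⟨v, -, rfl⟩ | hz2)
  · exact dualPt_notMem_segment hm v hz1
  · obtain ⟨f, hf, hz2⟩ := Set.mem_iUnion₂.1 hz2
    have hadj : LatticeAdj f.1 f.2 := forall_zip_tail_of_isChain hβ f hf
    exact h f hf (stepD_and_edge_eq_of_mem hm hadj hz1 hz2)

/-! ### Manhattan edges versus the junction diagonals -/

/-- **A Manhattan edge meets a junction diagonal only at its Peano endpoint.** If the closed edge
`[p, q]` of `G⃗` meets the segment `[x, v]` from the Peano vertex `x` to a point `v` at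
`‖·‖_∞`-distance `¼` in both coordinates (an adjacent primal or dual vertex), then the common
point is `x` and `x ∈ {p, q}`. [folklore] -/
theorem eq_peanoPt_of_mem_diag {p q x : ℤ × ℤ} {v z : ℂ} (hm : Manhattan p q)
    (hv : |(peanoPt x - v).re| = 1 / 4 ∧ |(peanoPt x - v).im| = 1 / 4)
    (hz1 : z ∈ segment ℝ (peanoPt p) (peanoPt q)) (hz2 : z ∈ segment ℝ (peanoPt x) v) :
    z = peanoPt x ∧ (x = p ∨ x = q) := by
  obtain ⟨b, hb0, hb1, hre, him⟩ := coords_of_mem_segment hz2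
  obtain ⟨c, hc0, hc1, hre1, him1⟩ := coords_of_mem_segment hz1
  obtain ⟨hvr, hvi⟩ := hv
  rw [sub_re] at hvr
  rw [sub_im] at hvi
  -- the displacement along the diagonal has equal coordinates `b/4` in absolute value
  have hdr : |z.re - (peanoPt x).re| = b / 4 := by
    rw [hre, add_sub_cancel_left, abs_mul, abs_of_nonneg hb0, abs_sub_comm, hvr]; ring
  have hdi : |z.im - (peanoPt x).im| = b / 4 := by
    rw [him, add_sub_cancel_left, abs_mul, abs_of_nonneg hb0, abs_sub_comm, hvi]; ring
  simp only [peanoPt_re, peanoPt_im] at hre1 him1 hdr hdi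
  obtain ⟨i, j⟩ := p; obtain ⟨k, l⟩ := x
  -- the four directions of the edge
  rcases hm with ⟨rfl, -⟩ | ⟨rfl, -⟩ | ⟨rfl, -⟩ | ⟨rfl, -⟩ <;>
    simp only [Int.cast_add, Int.cast_sub, Int.cast_one] at hre1 him1
  · -- towards `+x`: `im` is constant along the edge
    have hzi : z.im = j / 2 + 1 / 4 := by rw [him1]; ring
    have hl : l = j := by
      rcases (abs_eq (by positivity : (0 : ℝ) ≤ b / 4)).1 hdi with h | h <;>
      · rw [hzi] at h
        exact int_eq_of_lt_of_lt (k := l) (c := j) (by linarith) (by linarith)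
    subst hl
    have hb : b = 0 := by
      rcases (abs_eq (by positivity : (0 : ℝ) ≤ b / 4)).1 hdi with h | h <;>
      · rw [hzi] at h; linarith
    rw [hb, zero_div, abs_eq_zero, sub_eq_zero] at hdr
    refine ⟨Complex.ext (by simp [hdr]) (by simp [hzi]), ?_⟩
    rcases int_eq_or_of_le_of_le (k := k) (c := i) (by linarith) (by linarith) with rfl | rfl
    · exact Or.inl rfl
    · exact Or.inr rfl
  · -- towards `-x`
    have hzi : z.im = j / 2 + 1 / 4 := by rw [him1]; ring
    have hl : l = j := by
      rcases (abs_eq (by positivity : (0 : ℝ) ≤ b / 4)).1 hdi with h | h <;>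
      · rw [hzi] at h
        exact int_eq_of_lt_of_lt (k := l) (c := j) (by linarith) (by linarith)
    subst hl
    have hb : b = 0 := by
      rcases (abs_eq (by positivity : (0 : ℝ) ≤ b / 4)).1 hdi with h | h <;>
      · rw [hzi] at h; linarith
    rw [hb, zero_div, abs_eq_zero, sub_eq_zero] at hdr
    refine ⟨Complex.ext (by simp [hdr]) (by simp [hzi]), ?_⟩
    rcases int_eq_or_of_le_of_le (k := k) (c := i - 1) (by push_cast; linarith)
      (by push_cast; linarith) with rfl | rfl
    · exact Or.inr rfl
    · exact Or.inl (by simp)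
  · -- towards `+y`: `re` is constant along the edge
    have hzr : z.re = i / 2 + 1 / 4 := by rw [hre1]; ring
    have hk : k = i := by
      rcases (abs_eq (by positivity : (0 : ℝ) ≤ b / 4)).1 hdr with h | h <;>
      · rw [hzr] at h
        exact int_eq_of_lt_of_lt (k := k) (c := i) (by linarith) (by linarith)
    subst hk
    have hb : b = 0 := by
      rcases (abs_eq (by positivity : (0 : ℝ) ≤ b / 4)).1 hdr with h | h <;>
      · rw [hzr] at h; linarith
    rw [hb, zero_div, abs_eq_zero, sub_eq_zero] at hdi
    refine ⟨Complex.ext (by simp [hzr]) (by simp [hdi]), ?_⟩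
    rcases int_eq_or_of_le_of_le (k := l) (c := j) (by linarith) (by linarith) with rfl | rfl
    · exact Or.inl rfl
    · exact Or.inr rfl
  · -- towards `-y`
    have hzr : z.re = i / 2 + 1 / 4 := by rw [hre1]; ring
    have hk : k = i := by
      rcases (abs_eq (by positivity : (0 : ℝ) ≤ b / 4)).1 hdr with h | h <;>
      · rw [hzr] at h
        exact int_eq_of_lt_of_lt (k := k) (c := i) (by linarith) (by linarith)
    subst hk
    have hb : b = 0 := by
      rcases (abs_eq (by positivity : (0 : ℝ) ≤ b / 4)).1 hdr with h | h <;>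
      · rw [hzr] at h; linarith
    rw [hb, zero_div, abs_eq_zero, sub_eq_zero] at hdi
    refine ⟨Complex.ext (by simp [hzr]) (by simp [hdi]), ?_⟩
    rcases int_eq_or_of_le_of_le (k := l) (c := j - 1) (by push_cast; linarith)
      (by push_cast; linarith) with rfl | rfl
    · exact Or.inr rfl
    · exact Or.inl (by simp)

end USTPeano

end Literature.Probability.RandomPlanarGeometry
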